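import Summits.BirchSwinnertonDyer.BirchSwinnertonDyer.Theorems.EdixhovenFibreFiveSevenStarredOptimalManinUnitFiveSevenOfOrdinaryCapstone
import Summits.BirchSwinnertonDyer.BirchSwinnertonDyer.Theorems.EdixhovenFibreFiveSevenStarredOptimalManinUnitFiveSevenUnitRootReciprocityTransport
import Literature.NumberTheory.PAdicHodge.AinfRamifiedOmegaPeriodNonvanishingOrdinary
import HarnessLib

/-!
# STUB `stub_localFormulaOrdinaryCells` of skeleton v11 — PROVED; the ordinary capstone socket `hcap` DISCHARGED; K★ ⟸ P1-bar alone
# (route `EdixhovenFibreFiveSeven`, crux K★ stmt-BirchSwinnertonDyer-22226, line `kato-lever`; seat `bsd-line-edix-p4` g30, width)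

HONEST FRAMING. Three theorems (no definition, no named fact, no instance, no `sorry`). The crux K★ stays OPEN ⟸ {P1-bar `stub_sl2NeronValues` (print XL)};
**BSD is not proved by any of this.**

* ★★★ `ordinaryCapstone` — THE ORDINARY CAPSTONE SOCKET `hCAP` of `…OfOrdinaryCapstone.starredOptimalManinUnitFiveSeven_of_ordinaryCapstone` (= the universal
  closure over the stub's binders of the hypothesis `hcap` of `…LocalFormulaOrdinaryCellsOfCapstone.localFormulaOrdinaryCells_of_capstone`, width seat g29), PROVED:
  Kato's explicit reciprocity law at the points of `W′(K_{v′})` over deep FORMAL points of every good ordinary `𝒪_D`-model datum of a (G)-ordinary K★ cell, in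
  transport form, at depth `N := e`. Assembly: the unit-root frame along the transport (`…UnitRootReciprocityTransport`, this seat: E3-ord ∘ p797918 ∘ the LEAD
  lineage's B1–B6/B3) fed with (N1″) — `∫_{v₀} ω_{W_D} ≠ 0` for the generator `v₀` of the height-one formal Tate module (LEAD edix-p1 g32,
  `AinfRamTop.omegaPeriod_seqO_ne_zero_of_generator`, p798323) — the `h1`-currencies bridged by `AinfRamTop.algebraMap_ψ_eq`.
* ★★★★ `stub_localFormulaOrdinaryCells` — the registered stub BY NAME AND SIGNATURE (`localFormulaOrdinaryCells_of_capstone` ∘ `ordinaryCapstone`): Kato's explicit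
  reciprocity FORMULA `⟨[η″], P′⟩ = Tr_{K_{v′}/ℚ_p}(c′ · exp*_{d″}(η″) · log_{ω′} P′)` (`∀ d″ ∃ c′`) for the DIRECT representation of every globally minimal `W′/ℚ` IN
  the (G)-ordinary starred cells `(5; III*), (7; IV*), (7; II*)` over `K_{v′}` (`K ∋ p^{1/e}`, cell table `4, 3, 6`), every compatible `ω′`, every ALTERNATING Weil tower.
* ★★★ `starredOptimalManinUnitFiveSeven_of_sl2NeronValuesBar` — **K★ ⟸ P1-bar** (`Kato2004.exists_member_sl2ZetaElement_neron_values_bar`, print XL) BY NAME.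

References: [Kato1993LNM1553] Ch. II Thm. 1.4.1 (3)–(4), Lemma 1.4.3–1.4.5; [BlochKato1990] Ex. 3.10.1, Example 3.11; [Kato2004Asterisque] (8.1.3), Thm. 9.7, Thm. 6.6 (1);
[Tate1967] §4; [Fontaine1982FormesDifferentielles] §5; [SilvermanATAEC1994] IV Table 4.1.
-/

set_option autoImplicit false
-- single-conjunct summit: `Summit.BirchSwinnertonDyer.BirchSwinnertonDyer.…` repeats the name by design
set_option linter.dupNamespace false

noncomputable section

open Field Function ValuativeRel WittVector NumberField IsDedekindDomain Polynomial
open scoped NumberField Topology Classical NNReal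
open Literature.NumberTheory.PAdicHodge Literature.NumberTheory.GaloisRepresentations
  Literature.NumberTheory.GaloisRepresentations.IsNonarchimedeanLocalField Literature.NumberTheory.GaloisRepresentations.LubinTate
  Literature.NumberTheory.GaloisCohomology Literature.NumberTheory.EllipticCurves Literature.NumberTheory.EllipticCurves.FormalGroupChart
  Literature.NumberTheory.PAdicHodge.GaloisContinuity Literature.IUT.LogVolume Literature.RingTheory.FormalGroups
  Literature.AlgebraicGeometry.Resolution _root_.WeierstrassCurve
  Literature.NumberTheory.EllipticCurves.Rank1Residual Literature.NumberTheory.DiophantineGeometry Rat.HeightOneSpectrum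
  Literature.NumberTheory.EllipticCurves.Kato2004
  Summit.BirchSwinnertonDyer.Rank1Residual Summit.BirchSwinnertonDyer.Rank1Residual.Additive
  Summit.BirchSwinnertonDyer.BirchSwinnertonDyer.Theorems

namespace Summit.BirchSwinnertonDyer.BirchSwinnertonDyer.Theorems.StarredOptimalManinUnitFiveSevenLocalFormulaOrdinaryCells

set_option maxHeartbeats 3200000 in
/-- ★★★ **THE ORDINARY CAPSTONE SOCKET, PROVED.** For every curve and datum as in the stub `stub_localFormulaOrdinaryCells` (its binders verbatim) and every good
ordinary `𝒪_D`-model datum of the cell over `F = K_{v′}` with its reduction / CM-fibre data (`D`, `a b`, `Wm`, `ψ₀`, the cells' unit, `Δ ∈ 𝒪_Fˣ`, `A_p ≠ 0`,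
`[Xᵖ][p] ∈ 𝒪_ℂˣ`, `E₀ ≡ Wm (mod ϱ)`, `p ∤ Δ(E₀)`, `‖a_p(E₀)‖ = 1`, …) and every socket datum of `W` over `F`: at depth `N := e`, for every `Γ_F`-equivariant
`φ : (W ⊗ F)(F̄) ≃ E(F̄)` with Tate-module map, ONE `c ∈ F` gives `⟨[η], P⟩_W = −Tr_{F/ℚ_p}(c_P · exp*_d(η) · c)` at every cocycle `η` and every `P ∈ W(F)` carrying a
division tower whose image `φ ∘ Q` is formal with `‖z(φ Q₀)‖^e ≤ ‖p‖`, for every `c_P` with `ι(c_P) = p^e·Σ'[Xʲ]log_{W_D}·z(φ Q₀)ʲ`. Proof: (N1″) for the generator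
`v₀` of `T_pŴ_D` (`FormalTateModuleRankOne` + `AinfRamTop.omegaPeriod_seqO_ne_zero_of_generator`), then
`UnitRootReciprocityTransport.exists_const_tatePairingPoint_eq_neg_trace_of_omegaPeriod_ne_zero_unitRoot_transport`.
[cite: Kato1993LNM1553, Ch. II Thm. 1.4.1 (3)–(4), Lemma 1.4.3] [cite: BlochKato1990, Ex. 3.10.1, Example 3.11] [cite: Tate1967, §4]
[cite: Fontaine1982FormesDifferentielles, §5] -/
theorem ordinaryCapstone (W : WeierstrassCurve ℚ) [W.IsElliptic] [W.IsGloballyMinimal] (p : ℕ) [Fact p.Prime]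
    (hp57 : p = 5 ∨ p = 7) (_hadd : Addv W p)
    (_hIstar : ∀ (v : HeightOneSpectrum ℤ) (n : ℕ), natGenerator v = p → W.kodairaSymbolAt v ≠ KodairaSymbol.Istar n)
    (_h4 : 4 < padicValInt p W.minimalDiscriminantInt) (_h9 : p = 5 ↔ padicValInt p W.minimalDiscriminantInt = 9)
    {K : Type} [Field K] [NumberField K] (_α : K) {e : ℕ}
    (_htab : p = 5 ∧ padicValInt p W.minimalDiscriminantInt = 9 ∧ e = 4 ∨ p = 7 ∧ padicValInt p W.minimalDiscriminantInt = 8 ∧ e = 3 ∨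
      p = 7 ∧ padicValInt p W.minimalDiscriminantInt = 10 ∧ e = 6) (_hαe : _α ^ e = (p : K))
    (v' : HeightOneSpectrum (𝓞 K)) (_hv' : ((p : ℕ) : 𝓞 K) ∈ v'.asIdeal)
    [CharZero (v'.adicCompletion K)] [Fact (¬ IsUnit ((p : ℕ) : integerC (v'.adicCompletion K)))]
    [IsAdicComplete (Ideal.span {((p : ℕ) : integerC (v'.adicCompletion K))}) (integerC (v'.adicCompletion K))]
    (hp' : valuation (v'.adicCompletion K) ((p : ℕ) : (v'.adicCompletion K)) < 1)
    (ω' : Valuation (v'.adicCompletion K) ℝ≥0) [ω'.Compatible] [(W.baseChange (v'.adicCompletion K)).IsIntegral ω'.integer]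
    (eT : (k : ℕ) → geomTorsion W ((p ^ k : ℕ) : ℤ) → geomTorsion W ((p ^ k : ℕ) : ℤ) → AlgebraicClosure ℚ) (hμ : ∀ k S T, eT k S T ^ (p ^ k) = 1)
    (hadd₁ : ∀ k S₁ S₂ T, eT k (S₁ + S₂) T = eT k S₁ T * eT k S₂ T) (hadd₂ : ∀ k S T₁ T₂, eT k S (T₁ + T₂) = eT k S T₁ * eT k S T₂)
    (hgal : ∀ k (σ : absoluteGaloisGroup ℚ) (S T : geomTorsion W ((p ^ k : ℕ) : ℤ)), σ • eT k S T = eT k (σ • S) (σ • T))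
    (_hnondeg : ∀ k (T : geomTorsion W ((p ^ k : ℕ) : ℤ)), (∀ S, eT k S T = 1) → T = 0) (_halt : ∀ k (S : geomTorsion W ((p ^ k : ℕ) : ℤ)), eT k S S = 1)
    (hcompat : ∀ k (S T : geomTorsion W ((p ^ (k + 1) : ℕ) : ℤ)),
      eT k (torsionMulHom W (p ^ (k + 1)) (p ^ k) p (pow_succ p k).symm S) (torsionMulHom W (p ^ (k + 1)) (p ^ k) p (pow_succ p k).symm T) = eT (k + 1) S T ^ p)
    (_hinjK : letI := LocalField.adicCompletionPadicAlgebra v' p _hv'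
      (bdRPeriodRingData (F := (v'.adicCompletion K)) (p := p) hp').CupLogInjective (logCyclotomic p) (restrictedRationalTateRep W (v'.adicCompletion K) p))
    (_hdeK : letI := LocalField.adicCompletionPadicAlgebra v' p _hv'
      ∀ z : contOneCocycles (restrictedRationalTateRep W (v'.adicCompletion K) p).toTopRep,
        (bdRPeriodRingData (F := (v'.adicCompletion K)) (p := p) hp').HasDualExp (logCyclotomic p) (restrictedRationalTateRep W (v'.adicCompletion K) p) fun σ => z.1 σ)
    (_d'' : letI := LocalField.adicCompletionPadicAlgebra v' p _hv'
      (bdRPeriodRingData (F := (v'.adicCompletion K)) (p := p) hp').FilZeroLine (restrictedRationalTateRep W (v'.adicCompletion K) p)) :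
    letI := LocalField.padicAlgebra (v'.adicCompletion K) p hp'
    haveI : CharZero (CompletedAlgClosure (v'.adicCompletion K)) :=
      charZero_of_injective_algebraMap (algebraMap (v'.adicCompletion K) (CompletedAlgClosure (v'.adicCompletion K))).injective
    ∀ (r₄ r₆ t₄ t₆ : ℕ), ((p = 5 → r₄ = 0 ∧ t₄ = 0 ∧ 0 < t₆) ∧ (p = 7 → r₆ = 0 ∧ t₆ = 0 ∧ 0 < t₄)) →
    ∀ (D : EisensteinRoot (v'.adicCompletion K) p hp') (_hD : D.poly = X ^ e - C (p : ℤ_[p])) (a b : ℤ)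
      (Wm : WeierstrassCurve (EisensteinRoot.CoeffDisc D)) (ψ₀ : EisensteinRoot.CoeffDisc D →+* LTCoeff (v'.adicCompletion K))
      (_hψ₀ : ∀ c, algebraMap (LTCoeff (v'.adicCompletion K)) (v'.adicCompletion K) (ψ₀ c) = EisensteinRoot.CoeffDisc.toF D c)
      (_hWm : Wm = ⟨0, 0, 0, algebraMap ℤ (EisensteinRoot.CoeffDisc D) a * EisensteinRoot.CoeffDisc.of D (AdjoinRoot.root D.poly) ^ r₄,
        algebraMap ℤ (EisensteinRoot.CoeffDisc D) b * EisensteinRoot.CoeffDisc.of D (AdjoinRoot.root D.poly) ^ r₆⟩)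
      (_hu : IsUnit (64 * (a : ℤ_[p]) ^ 3 * (p : ℤ_[p]) ^ t₄ + 432 * (b : ℤ_[p]) ^ 2 * (p : ℤ_[p]) ^ t₆))
      (_hΔ : IsUnit (Wm.map ψ₀).Δ) (_hA : ((Wm.map ψ₀).map (AinfTop.redCoeff (v'.adicCompletion K))).hasseCoeff p ≠ 0)
      (_h1 : IsUnit (algebraMap (LTCoeff (v'.adicCompletion K)) (CBall (v'.adicCompletion K)) (PowerSeries.coeff p ((Wm.map ψ₀).formalMul p))))
      [(AinfTop.curveFO (v'.adicCompletion K) (Wm.map ψ₀)).IsElliptic]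
      [(curveOver (CompletedAlgClosure (v'.adicCompletion K)) (Wm.map ψ₀)).IsElliptic]
      (E₀ : WeierstrassCurve ℤ) (_hE₀ : E₀ = ⟨0, 0, 0, if r₄ = 0 then a else 0, if r₆ = 0 then b else 0⟩)
      (_hWE : Wm.map (Ideal.Quotient.mk (Ideal.span {EisensteinRoot.CoeffDisc.of D (AdjoinRoot.root D.poly)})) =
        (E₀.map (algebraMap ℤ (EisensteinRoot.CoeffDisc D))).map (Ideal.Quotient.mk (Ideal.span {EisensteinRoot.CoeffDisc.of D (AdjoinRoot.root D.poly)})))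
      (_hΔ₀ : ¬ (p : ℤ) ∣ E₀.Δ) (_hA₀ : (E₀.map (Int.castRingHom (ZMod p))).hasseCoeff p ≠ 0)
      (_htr : ¬ (p : ℤ) ∣ HasseManin.tr (E₀.map (Int.castRingHom (ZMod p))))
      (_hnorm : ‖((HasseManin.tr (E₀.map (Int.castRingHom (ZMod p))) : ℤ) : ℤ_[p])‖ = 1)
      (_hsq : HasseManin.tr (E₀.map (Int.castRingHom (ZMod p))) ^ 2 < 4 * p)
      [(E₀.map (Int.castRingHom ℚ_[p])).IsElliptic] [(E₀.map (Int.castRingHom (ZMod p))).IsElliptic]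
      [(curveOver (CompletedAlgClosure (v'.adicCompletion K)) E₀).IsElliptic]
      -- socket data of `W` over `F`
      (ψ : C(absoluteGaloisGroup (v'.adicCompletion K), ℤ_[p])) (_hψ : ∀ σ τ, ψ (σ * τ) = ψ σ + ψ τ)
      (_hψlog : ∀ τ, (ψ τ : ℚ_[p]) = logCyclotomic (F := (v'.adicCompletion K)) p τ)
      (_heL : ∀ (c : ℤ_[p]) (S U : W.tateModule p),
        (weilContPairingPadic W (v'.adicCompletion K) p eT hμ hadd₁ hadd₂ hgal hcompat).toLin (c • S) U =
        twistHom (v'.adicCompletion K) p ((weilContPairingPadic W (v'.adicCompletion K) p eT hμ hadd₁ hadd₂ hgal hcompat).toLin S U) c)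
      (_healt : ∀ S : W.tateModule p, (weilContPairingPadic W (v'.adicCompletion K) p eT hμ hadd₁ hadd₂ hgal hcompat).toLin S S = 0)
      (_henondeg : ∀ S : W.tateModule p,
        (∀ U, (weilContPairingPadic W (v'.adicCompletion K) p eT hμ hadd₁ hadd₂ hgal hcompat).toLin S U = 0) → S = 0)
      (_hinj : (bdRPeriodRingData (F := (v'.adicCompletion K)) (p := p) hp').CupLogInjective (logCyclotomic p)
        (restrictedRationalTateRep W (v'.adicCompletion K) p))
      (_hde : ∀ η : contOneCocycles (restrictedTateRep W (v'.adicCompletion K) p).toTopRep,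
        (bdRPeriodRingData (F := (v'.adicCompletion K)) (p := p) hp').HasDualExp (logCyclotomic p)
          (restrictedRationalTateRep W (v'.adicCompletion K) p) fun σ => TateModule.toRational p (η.1 σ))
      (d : (bdRPeriodRingData (F := (v'.adicCompletion K)) (p := p) hp').FilZeroLine (restrictedRationalTateRep W (v'.adicCompletion K) p))
      -- a depth `N ≥ 1`, then: the transport isomorphism onto the model and its Tate-module map
      , ∃ N : ℕ, N ≠ 0 ∧
    ∀ (φ : geomPoints (W.baseChange (v'.adicCompletion K)) ≃+ (AinfTop.curveFO (v'.adicCompletion K) (Wm.map ψ₀)).geomPoints)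
      (_hφ : ∀ (σ : absoluteGaloisGroup (v'.adicCompletion K)) (P : geomPoints (W.baseChange (v'.adicCompletion K))), φ (σ • P) = σ • φ P)
      (Tφ : (W.baseChange (v'.adicCompletion K)).tateModule p ≃ₗ[ℤ_[p]] (AinfTop.curveFO (v'.adicCompletion K) (Wm.map ψ₀)).tateModule p)
      (_hTφ : ∀ (a : (W.baseChange (v'.adicCompletion K)).tateModule p) (n : ℕ), TateModule.proj p n (Tφ a) = φ (TateModule.proj p n a)),
    ∃ c : v'.adicCompletion K,
    ∀ (η : contOneCocycles (restrictedTateRep W (v'.adicCompletion K) p).toTopRep)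
      (P : (W.baseChange (v'.adicCompletion K)).toAffine.Point)
      (Q : ℕ → geomPoints (W.baseChange (v'.adicCompletion K)))
      (_hQ : ∀ n, p • Q (n + 1) = Q n)
      (_hQ0 : Q 0 = toGeomPoints (W.baseChange (v'.adicCompletion K)) P)
      (hker : ∀ n, AinfTop.geomToCO (Wm.map ψ₀) ((⇑φ ∘ Q) n) ∈ kernel (NormedField.valuation (K := CompletedAlgClosure (v'.adicCompletion K)))
        (curveOver (CompletedAlgClosure (v'.adicCompletion K)) (Wm.map ψ₀))),
      ‖((zPt (AinfTop.geomToCO (Wm.map ψ₀) ((⇑φ ∘ Q) 0)) (hker 0) : CBall (v'.adicCompletion K)) : CompletedAlgClosure (v'.adicCompletion K))‖ ^ N ≤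
          ‖(p : CompletedAlgClosure (v'.adicCompletion K))‖ →
      ∀ cP : v'.adicCompletion K,
        algebraMap (v'.adicCompletion K) (CompletedAlgClosure (v'.adicCompletion K)) cP =
          (p : CompletedAlgClosure (v'.adicCompletion K)) ^ N *
            ∑' j : ℕ, PowerSeries.coeff j (Wm.map ((CBall (v'.adicCompletion K)).subtype.comp (EisensteinRoot.CoeffDisc.toCBall D))).formalLog *
              ((zPt (AinfTop.geomToCO (Wm.map ψ₀) ((⇑φ ∘ Q) 0)) (hker 0) : CBall (v'.adicCompletion K)) : CompletedAlgClosure (v'.adicCompletion K)) ^ j →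
        ((tatePairingPoint W (v'.adicCompletion K) p eT hμ hadd₁ hadd₂ hgal hcompat (oneCocycleClass _ η) P : ℤ_[p]) : ℚ_[p]) =
          -Algebra.trace ℚ_[p] (v'.adicCompletion K) (cP * (expStarCoord W hp' d η * c)) := by
  letI := LocalField.padicAlgebra (v'.adicCompletion K) p hp'
  haveI : CharZero (CompletedAlgClosure (v'.adicCompletion K)) :=
    charZero_of_injective_algebraMap (algebraMap (v'.adicCompletion K) (CompletedAlgClosure (v'.adicCompletion K))).injective
  haveI : CharP 𝓀[v'.adicCompletion K] p := StarredOptimalManinUnitFiveSevenSupersingularCellsModels.charP_residueField_of_valuation_lt_one hp'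
  intro r₄ r₆ t₄ t₆ _hpat D _hD a b Wm ψ₀ hψ₀ _hWm _hu hΔ _hA h1 _ _ E₀ _hE₀ hWE _hΔ₀ _hA₀ _htr hnorm _hsq _ _ _ ψ hψ hψlog heL healt henondeg
    hinj hde d
  have hp2 : p ≠ 2 := fun h => by rcases hp57 with h5 | h7 <;> omega
  refine ⟨D.e, D.e_pos.ne', fun φ hφ Tφ hTφ => ?_⟩
  -- (N1″) at the generator `v₀` of the height-one formal Tate module (LEAD edix-p1 g32), in the `𝒪_D`-currency of `[Xᵖ][p]`
  have hunit : IsUnit (algebraMap (EisensteinRoot.CoeffDisc D) (CBall (v'.adicCompletion K)) (PowerSeries.coeff p (Wm.formalMul p))) := by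
    rw [← AinfRamTop.algebraMap_ψ_eq ψ₀ hψ₀, ← PowerSeries.coeff_map, WeierstrassCurve.map_formalMul]
    exact h1
  obtain ⟨v₀, hv₀, hgen, -⟩ := exists_generator_tatePtO_of_isUnit (norm_natCast_C_lt_one hp') (Wm.map ψ₀) h1
  have hN1' : ∃ τ : AinfTop.TatePtO (v'.adicCompletion K) (Wm.map ψ₀) p,
      AinfRamTop.omegaPeriod Wm (surjective_fontaineTheta_integerC hp') (AinfTop.seqO (Wm.map ψ₀) τ) (AinfTop.seqO_zero (Wm.map ψ₀) τ)
        (AinfRamTop.mulPC_seqO Wm ψ₀ hψ₀ τ) ≠ 0 :=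
    ⟨v₀, AinfRamTop.omegaPeriod_seqO_ne_zero_of_generator Wm ψ₀ hψ₀ hunit hv₀ hgen⟩
  -- the unit-root frame along `φ`, from the cells' data and (N1′) (this seat, E3-ord)
  -- (STEPWISE application: a one-shot application of this many-binder theorem is slow to elaborate)
  have hE1 := UnitRootReciprocityTransport.exists_const_tatePairingPoint_eq_neg_trace_of_omegaPeriod_ne_zero_unitRoot_transport v' hp' D Wm ψ₀ hψ₀
    hp2 hΔ h1 W φ hφ Tφ hTφ eT hμ hadd₁ hadd₂ hgal hcompat E₀ hWE hnorm (N := D.e) le_rfl hN1'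
  have hE2 := hE1 ψ hψ hψlog heL healt henondeg
  exact hE2 hinj hde d

set_option maxHeartbeats 1600000 in
/-- ★★★★ **STUB `stub_localFormulaOrdinaryCells` OF SKELETON v11, PROVED** — Kato's explicit reciprocity FORMULA
`⟨[η″], P′⟩ = Tr_{K_{v′}/ℚ_p}(c′ · exp*_{d″}(η″) · log_{ω′} P′)` (`∀ d″ ∃ c′`) for the DIRECT representation `V_pW′|_{Γ_{K_{v′}}}` of every globally minimal `W′/ℚ`
IN the (G)-ORDINARY K★ cells `(5; III*), (7; IV*), (7; II*)`, over the completion `K_{v′}` of ANY number field `K ∋ p^{1/e}` (cell table `4, 3, 6`) at ANY place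
`v′ ∋ p`, for every compatible `ω′`, every ALTERNATING Weil tower of `W′` and the Prop-1.2.3 binders of the direct representation
(`localFormulaOrdinaryCells_of_capstone` ∘ `ordinaryCapstone`). [cite: Kato1993LNM1553, Ch. II Thm. 1.4.1 (3)–(4), Lemma 1.4.3–1.4.5 and §1.2.4]
[cite: BlochKato1990, Prop. 3.8 (p. 354), Example 3.11 (p. 361)] [cite: SilvermanATAEC1994, IV Table 4.1] -/
theorem stub_localFormulaOrdinaryCells :
    ∀ (W' : WeierstrassCurve ℚ) [W'.IsElliptic] [W'.IsGloballyMinimal] (p : ℕ) [Fact p.Prime], (p = 5 ∨ p = 7) → Addv W' p → Irr W' p →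
      (∀ (v : HeightOneSpectrum ℤ) (n : ℕ), natGenerator v = p → W'.kodairaSymbolAt v ≠ KodairaSymbol.Istar n) →
      4 < padicValInt p W'.minimalDiscriminantInt → (p = 5 ↔ padicValInt p W'.minimalDiscriminantInt = 9) →
      ∀ {K : Type} [Field K] [NumberField K] (α : K) (e : ℕ),
      (p = 5 ∧ padicValInt p W'.minimalDiscriminantInt = 9 ∧ e = 4 ∨ p = 7 ∧ padicValInt p W'.minimalDiscriminantInt = 8 ∧ e = 3 ∨
        p = 7 ∧ padicValInt p W'.minimalDiscriminantInt = 10 ∧ e = 6) → α ^ e = (p : K) →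
      ∀ (v' : HeightOneSpectrum (𝓞 K)) (hv' : ((p : ℕ) : 𝓞 K) ∈ v'.asIdeal)
      [CharZero (v'.adicCompletion K)] [Fact (¬ IsUnit ((p : ℕ) : integerC (v'.adicCompletion K)))]
      [IsAdicComplete (Ideal.span {((p : ℕ) : integerC (v'.adicCompletion K))}) (integerC (v'.adicCompletion K))]
      (hp' : valuation (v'.adicCompletion K) ((p : ℕ) : (v'.adicCompletion K)) < 1)
      (ω' : Valuation (v'.adicCompletion K) ℝ≥0) [ω'.Compatible] [(W'.baseChange (v'.adicCompletion K)).IsIntegral ω'.integer],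
      letI := LocalField.adicCompletionPadicAlgebra v' p hv'
      ∀ (e : (k : ℕ) → geomTorsion W' ((p ^ k : ℕ) : ℤ) → geomTorsion W' ((p ^ k : ℕ) : ℤ) → AlgebraicClosure ℚ) (hμ : ∀ k S T, e k S T ^ (p ^ k) = 1)
      (hadd₁ : ∀ k S₁ S₂ T, e k (S₁ + S₂) T = e k S₁ T * e k S₂ T) (hadd₂ : ∀ k S T₁ T₂, e k S (T₁ + T₂) = e k S T₁ * e k S T₂)
      (hgal : ∀ k (σ : absoluteGaloisGroup ℚ) (S T : geomTorsion W' ((p ^ k : ℕ) : ℤ)), σ • e k S T = e k (σ • S) (σ • T))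
      (_hnondeg : ∀ k (T : geomTorsion W' ((p ^ k : ℕ) : ℤ)), (∀ S, e k S T = 1) → T = 0) (_halt : ∀ k (S : geomTorsion W' ((p ^ k : ℕ) : ℤ)), e k S S = 1)
      (hcompat : ∀ k (S T : geomTorsion W' ((p ^ (k + 1) : ℕ) : ℤ)),
      e k (torsionMulHom W' (p ^ (k + 1)) (p ^ k) p (pow_succ p k).symm S) (torsionMulHom W' (p ^ (k + 1)) (p ^ k) p (pow_succ p k).symm T) = e (k + 1) S T ^ p),
      (bdRPeriodRingData (F := (v'.adicCompletion K)) (p := p) hp').CupLogInjective (logCyclotomic p) (restrictedRationalTateRep W' (v'.adicCompletion K) p) →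
      (∀ z : contOneCocycles (restrictedRationalTateRep W' (v'.adicCompletion K) p).toTopRep,
        (bdRPeriodRingData (F := (v'.adicCompletion K)) (p := p) hp').HasDualExp (logCyclotomic p) (restrictedRationalTateRep W' (v'.adicCompletion K) p) fun σ => z.1 σ) →
      ∀ d'' : (bdRPeriodRingData (F := (v'.adicCompletion K)) (p := p) hp').FilZeroLine (restrictedRationalTateRep W' (v'.adicCompletion K) p), ∃ c' : (v'.adicCompletion K),
      ∀ (η'' : contOneCocycles (restrictedTateRep W' (v'.adicCompletion K) p).toTopRep) (P' : (W'.baseChange (v'.adicCompletion K)).toAffine.Point),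
      ((tatePairingPoint W' (v'.adicCompletion K) p e hμ hadd₁ hadd₂ hgal hcompat (oneCocycleClass _ η'') P' : ℤ_[p]) : ℚ_[p]) =
        Algebra.trace ℚ_[p] (v'.adicCompletion K) (c' * expStarCoord W' hp' d'' η'' * padicLogPointFiniteExt ω' (W'.baseChange (v'.adicCompletion K)) p P') := by
  intro W' _ _ p _ hp57 hadd _hirr hIstar h4 h9 K _ _ α e htab hαe v' hv' _ _ _ hp' ω' _ _ eT hμ hadd₁ hadd₂ hgal hnondeg halt hcompat hinjK hdeK d''
  exact StarredOptimalManinUnitFiveSevenLocalFormulaOrdinaryCellsOfCapstone.localFormulaOrdinaryCells_of_capstone W' p hp57 hadd hIstar h4 h9 α htab hαe v'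
    hv' hp' ω' eT hμ hadd₁ hadd₂ hgal hnondeg halt hcompat hinjK hdeK d''
    (ordinaryCapstone W' p hp57 hadd hIstar h4 h9 α htab hαe v' hv' hp' ω' eT hμ hadd₁ hadd₂ hgal hnondeg halt hcompat hinjK hdeK d'')

/-- ★★★ **K★ ⟸ P1-bar alone, BY NAME**: with `ordinaryCapstone` the conditional closer `…OfOrdinaryCapstone.starredOptimalManinUnitFiveSeven_of_ordinaryCapstone`
(LOC@ord ⟸ hCAP, DD landed, LOC@ss landed) leaves only Kato's `SL₂(ℤ)`-type zeta-element values in the Néron coordinate (print XL).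
[cite: Kato2004Asterisque, (8.1.3) (p. 180), Thm. 9.7 (p. 189), Thm. 6.6 (1) (p. 163)] [cite: Kato1993LNM1553, Ch. II Thm. 1.4.1 (3)–(4)] -/
theorem starredOptimalManinUnitFiveSeven_of_sl2NeronValuesBar (hP1 : exists_member_sl2ZetaElement_neron_values_bar) :
    Summit.BirchSwinnertonDyer.BirchSwinnertonDyer.Theses.EdixhovenFibreFiveSeven.StarredOptimalManinUnitFiveSeven :=
  StarredOptimalManinUnitFiveSevenOfOrdinaryCapstone.starredOptimalManinUnitFiveSeven_of_ordinaryCapstone ordinaryCapstone hP1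

end Summit.BirchSwinnertonDyer.BirchSwinnertonDyer.Theorems.StarredOptimalManinUnitFiveSevenLocalFormulaOrdinaryCells

end
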